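/-
Copyright: statement-level skeleton of a published paper (lit-balaban cell, Phase-2 proof seat p39 gen 9). No proof claims
beyond what the kernel checks below.
-/
import Literature.MathematicalPhysics.QuantumFieldTheory.Balaban1983to89.B3GkZeroLatticePointwise
import Literature.MathematicalPhysics.QuantumFieldTheory.Balaban1983to89.B3ZdKernelConvolutions
import Literature.MathematicalPhysics.QuantumFieldTheory.Balaban1983to89.B3CxiLatticePairSums

/-!
# B3 — T. Bałaban, *(Higgs)₂,₃ quantum fields in a finite volume. III. Renormalization*, CMP **88** (1983) 411–445
[Balaban1983Higgs3], p. 437 [PDF 27], the UNLABELLED in-text display preceding (3.16), ON THE PRINTED INFINITE LATTICE: the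
resolvent identity **G^ξ_{j″}(0) = C^ξ + G^ξ_{j″}(0)(1 − m²_{j″} − a_{j″}P_{j″})C^ξ** for the infinite-lattice zero-field propagator
`G_k(0)` of p. 433

statement-level skeleton of published theorems with citation tags; proofs where landed; nothing here is a claim about
the Yang–Mills mass gap

PDF held: `paper:balaban1983-higgs-2-3-quantum-fields-finite-volume` (journal page = PDF page + 410); p. 437 [PDF 27] read on the
×2 render `run/shared/lean/pub/pub-balaban/b2b-balaban-ref1/pages/1983-cmp88-higgs23-III/1983-cmp88-higgs23-III-p027-x2.png`,
verbatim: *"Next we replace G^ξ_{j″}(0) by C^ξ = (−Δ^ξ + 1)^{−1}: G^ξ_{j″}(0) = C^ξ + G^ξ_{j″}(0)(1 − m²_{j″} − a_{j″}P_{j″})C^ξ. We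
have Σ_{ν=1}^d ∂^ξ_νC^ξ∂^{ξ*}_ν = −Δ^ξC^ξ = δ^ξ − C^ξ and δ^ξ(y′ − y)(y′_μ − y_μ) = 0, so the expression is equal to"* [the
vertex-coefficient display, which carries the label (3.16)].  LOCATOR (v1.1, referee ref-1 gen 51): the resolvent identity
proved in this file is the unlabelled in-text display of p. 437 immediately PRECEDING (3.16); the label (3.16) itself belongs to
the following display `−q²Σ_{y′}ξ^dC^ξ(y−y′)g(y)G^ξ_{j″}(y,y′)g′(y′)(y′_μ−y_μ) + q²Σ_{y′}ξ^d(Σ_ν(∂^ξ_νG^ξ_{j″}(0)(1 − m²_{j″} −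
a_{j″}P_{j″})C^ξ∂^{ξ*}_ν)(y,y′))g(y)G^ξ_{j″}(y,y′)g′(y′)(y′_μ−y_μ)`, into whose second line the identity is substituted; wherever a
docstring below writes «(3.16)» of the resolvent identity it means this unlabelled display (the citation tags keep the page
locator `(3.16) p.437` of the passage).  With, p. 433 [PDF 23], *"we substitute G_k(□,0) = G_k(0) + δG_k(□,ηZ^d,0)"* — `G_k(0)` is
the propagator on the infinite lattice `ηℤ^d` (p03 gen 8's `B3GkZeroLattice.GkLat`, `η = ξ = L^{−k}`).  Rows **B3.Eq3.11-3.17** of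
`HOME/lit-balaban-r15/ROWS-B3.md` (fold owner r15); file 3 of the p39 gen-9 programme «the §3 vector self-energy sentences on
the PRINTED infinite lattice ξℤ³» (gen 7 of this seat, `B3Eq316ResolventZeroTorus`, did the torus reading).
v1.1 (r15 gen 10, B3 fold owner, 2026-08-22): DOCSTRING-ONLY — the header quote made verbatim and the locator of the identity
corrected per referee ref-1 gen 51 (F4+F1); §4/§6 docstrings reworded accordingly; no declaration, statement or proof changed.
WHAT IS REPRODUCED (`d = 3`; lattice `ℤ³ = ZSite 3` in fine units, spacing `ξ = n^{−1}`, `n = L^k`, `L = ℓ + 1 ≥ 2`; kernels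
w.r.t. the volume element `Σ_z ξ³`; `G^ξ_k(0;y,y′) = n³·GkLat(y,y′)` (`GxiL`) is the physical kernel of the counting-measure
inverse `GkLat`; the averaging operator `P_k = Q_k^*Q_k` is `(P f)(z) = Σ_{z′ ∈ block(z)} ξ³f(z′)` over the unit block — `n³` fine
sites — of `z` (`blockAvg`); `a_k = B1.aSeq a L k`):
* §0 the bridge between the two sup norms of the tree (`B3CxiUniformBound.supNorm`, ℕ-valued, and `B4ContourShift.supNorm`,
  ℝ-valued): `cast_supNorm_eq`.
* §1 DEFINITIONS `xiOf`, `GxiL`, `blockAvg`, `smearG` — the kernel of `G^ξ_k(0)(1 − m² − a_kP_k)` — and `MxiL = G^ξ_k(0) − C^ξ`.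
* §2 THE TWO LATTICE EQUATIONS as printed: `green_GxiL`: `(−Δ^ξ + m² + a_kP_k)G^ξ_k(0)(·,y) = δ^ξ_y` on ℤ³ (p03's `green_GkLat`
  — the row of the lattice operator expanded, `sum_opSupp_latOpK_mul`), and `green_Cxi_translate`: `(−Δ^ξ + 1)C^ξ(· − y′) = δ^ξ_{y′}`
  (r15's `negLapZ_Cxi_add`); `δ^ξ_y = ξ^{−3}1_{y}`.
* §3 MODEL-FREE: summation by parts for `−Δ^ξ` on ℤ³ against absolutely summable functions (`tsum_mul_negLapZ_comm`).
* §4 `hasSum_resolvent_of_equations` — the resolvent identity (display preceding (3.16)) in abstract form: two absolutely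
  summable solutions of the two lattice equations paired against each other; §6 **`hasSum_resolvent316`** / **`MxiL_eq_tsum`** —
  the resolvent identity PROVED on ξℤ³:
  `G^ξ_k(0;y,y′) − C^ξ(y−y′) = Σ'_z ξ³·[G^ξ_k(0)(1 − m² − a_kP_k)](y,z)·C^ξ(z−y′)` for all `y, y′`, with absolute convergence, for
  every `k ≥ 1`, `0 < a`, `0 ≤ m²` (rows of `G^ξ` and of the middle factor absolutely summable: `summable_abs_GxiL`,
  `summable_abs_smearG`).
* §5 KERNEL LAWS OF THE PIECES in the profile language `P_q^δ(u) = (ξ·max(1,|u|_∞))^{−q}e^{−δξ|u|_∞}` of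
  `B3ZdLatticeProfileSums`, uniform in `k ≥ 1` and the window `[a₋,a₊] × [0,m²₊]` (from `B3GkZeroLatticePointwise` and the block
  lemma `B3ZdKernelConvolutions.blockSum_profile_le`): `exists_GxiL_profile` (`|G^ξ| ≤ C·P₁^δ`, `ξ^{−1}|∂G^ξ|, ξ^{−1}|G^ξ∂^*| ≤ C·P₂^δ`,
  both variables, with one rate `0 < δ ≤ 1/2`), `exists_smearG_profile` (`|[G^ξ(1−m²−aP)](y,z)| ≤ C·P₁^δ(y−z)` and its first
  difference in `y` `≤ C·ξ·P₂^δ(y−z)`).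
HONEST SCOPE: zero external field (the printed case after the p. 433 gauge step), `d = 3`, unit blocks; the external-field
version `G_k(B̃)` of the identity is not treated.  This file proves the identity and the laws of its pieces; the estimate *"we can
estimate (3.16) by a constant"* for the (3.26) sums is assembled in `B3Pi2ZeroLattice`.  Mathlib + the cited tree files only;
definitions with bodies and theorems, no named facts; standard axioms.  Unit `lit-balaban-p39-g9` (Phase-2 proof seat p39,
gen 9), HOME `run/shared/lean/pub/lit-balaban/`, 2026-08-22.
-/

open scoped BigOperators
open Finset Filter Topology

namespace Literature.MathematicalPhysics.QuantumFieldTheory.Balaban1983to89.B3Eq316ResolventZeroLattice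

open B3Sect3VectorSelfEnergy B3CxiUniformBound B3ZdLatticeProfileSums B3ZdKernelConvolutions
open B3CxiPropagator (negLapZ negLapZ_Cxi_add summable_Cxi Cxi_nonneg)
open B3CxiLatticePairSums (abs_Cxi_le_profile abs_pdiffAdjZ_Cxi_le_profile abs_pdiffZ_Cxi_le_profile profile_shift_le
  supNorm_unitVec)
open B3GkZeroLattice (GkLat latOpK green_GkLat GkLat_comm)
open B4BoxCov237 (supNorm_sub_le_of_blk_eq)
open B4Reflection242 (blk mem_blockOf mem_nbrs)
open B3GkZeroLatticePointwise (abs_GkLat_profile abs_GkLatDiff_profile abs_GkLatDiff'_profile)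

noncomputable section

/-! ## §0 The two sup norms of the tree agree -/

/-- kernel: the ℕ-valued sup norm of `B3CxiUniformBound` and the ℝ-valued sup norm of `B4ContourShift` agree on `ℤ³`.
[cite: Balaban1983Higgs3, (3.16) p.437] -/
theorem cast_supNorm_eq (u : ZSite 3) : ((supNorm u : ℕ) : ℝ) = B4ContourShift.supNorm (d := 2) u := by
  apply le_antisymm
  · obtain ⟨μ, -, hμ⟩ := Finset.exists_mem_eq_sup Finset.univ Finset.univ_nonempty (fun μ : Fin 3 => (u μ).natAbs)
    have h1 : supNorm u = (u μ).natAbs := hμ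
    have h2 := B4ContourShift.abs_le_supNorm (d := 2) u μ
    rw [h1, Nat.cast_natAbs]
    exact h2
  · obtain ⟨i, hi⟩ := B4ContourShift.exists_supNorm_eq (d := 2) u
    have h := le_supNorm u i
    have h' : (((u i).natAbs : ℕ) : ℝ) ≤ (supNorm u : ℝ) := by exact_mod_cast h
    rw [hi, ← Nat.cast_natAbs]
    exact h'

/-- kernel: within one block of side `n` two sites are at sup distance `< n`. [cite: Balaban1983Higgs3, (3.16) p.437] -/
theorem supNorm_sub_lt_of_mem_blockOf {n : ℕ} (hn : 1 ≤ n) {z z' : ZSite 3} (hz' : z' ∈ B4Reflection242.blockOf (d := 2) n z) :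
    supNorm (z' - z) < n := by
  have h := supNorm_sub_le_of_blk_eq (d := 2) hn ((mem_blockOf hn).1 hz')
  rw [← cast_supNorm_eq] at h
  have : (supNorm (z' - z) : ℝ) < n := by linarith
  exact_mod_cast this

/-- kernel: a block of side `n` has `n³` sites. [cite: Balaban1983Higgs3, (3.16) p.437] -/
theorem card_blockOf (n : ℕ) (z : ZSite 3) : (B4Reflection242.blockOf (d := 2) n z).card = n ^ 3 := by
  unfold B4Reflection242.blockOf
  simp only [Fintype.card_piFinset, Int.card_Ico, add_sub_cancel_left, Int.toNat_natCast, Finset.prod_const,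
    Finset.card_univ, Fintype.card_fin]

/-! ## §1 Definitions -/

/-- the lattice spacing `ξ = η = L^{−k}` of the `k`-th step (`L = ℓ + 1`). [cite: Balaban1983Higgs3, (3.16) p.437] -/
def xiOf (ℓ k : ℕ) : ℝ := ((((ℓ : ℝ) + 1) ^ k))⁻¹

/-- **G^ξ_k(0; y, y′)** — the zero-field propagator `(−Δ^ξ + m² + a_kP_k)^{−1}` ON THE INFINITE LATTICE ξℤ³ of p. 433/(3.16), as
a kernel w.r.t. the volume element `Σ ξ³`: `n³·GkLat(y,y′)`, `n = L^k` (p03's `B3GkZeroLattice.GkLat` is the inverse matrix in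
counting measure). [cite: Balaban1983Higgs3, (3.16) p.437] -/
def GxiL (ℓ k : ℕ) (a m2 : ℝ) (y y' : ZSite 3) : ℝ := (((ℓ : ℝ) + 1) ^ k) ^ 3 * GkLat (d := 2) ℓ k a m2 y y'

/-- **P_k f** — the averaging operator `P_k = Q_k^*Q_k` of (3.16) on ξℤ³ with unit blocks: `(P f)(z) = Σ_{z′ ∈ block(z)} ξ³ f(z′)`,
the mean of `f` over the unit block (`n³` fine sites, `ξ³n³ = 1`) containing `z`. [cite: Balaban1983Higgs3, (3.16) p.437] -/
def blockAvg (ℓ k : ℕ) (f : ZSite 3 → ℝ) (z : ZSite 3) : ℝ :=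
  ∑ z' ∈ B4Reflection242.blockOf (d := 2) ((ℓ + 1) ^ k) z, (xiOf ℓ k) ^ 3 * f z'

/-- **[G^ξ_k(0)(1 − m² − a_kP_k)](y, z)** — the kernel of the middle factor of (3.16) applied to the propagator:
`(1 − m²)G^ξ(y,z) − a_k·(P_k G^ξ(y,·))(z)`, `a_k = B1.aSeq a L k`. [cite: Balaban1983Higgs3, (3.16) p.437] -/
def smearG (ℓ k : ℕ) (a m2 : ℝ) (y z : ZSite 3) : ℝ :=
  (1 - m2) * GxiL ℓ k a m2 y z - B1.aSeq a ((ℓ : ℝ) + 1) k * blockAvg ℓ k (GxiL ℓ k a m2 y) z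

/-- **the difference kernel of the resolvent identity** (p. 437, display preceding (3.16)): `M(y,y′) = G^ξ_k(0;y,y′) − C^ξ(y − y′)`
(`= [G^ξ_k(0)(1 − m² − a_kP_k)C^ξ](y,y′)`, `hasSum_resolvent316`; it is the kernel differentiated in the second line of (3.16)).
[cite: Balaban1983Higgs3, (3.16) p.437] -/
def MxiL (ℓ k : ℕ) (a m2 : ℝ) (y y' : ZSite 3) : ℝ := GxiL ℓ k a m2 y y' - Cxi 3 (xiOf ℓ k) (y - y')

section Basic

variable {ℓ k : ℕ} {a m2 : ℝ}

/-- kernel: `ξ > 0`. [cite: Balaban1983Higgs3, (3.16) p.437] -/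
theorem xiOf_pos (ℓ k : ℕ) : 0 < xiOf ℓ k := by unfold xiOf; positivity

/-- kernel: `ξ ≤ 1`. [cite: Balaban1983Higgs3, (3.16) p.437] -/
theorem xiOf_le_one (ℓ k : ℕ) : xiOf ℓ k ≤ 1 := by
  unfold xiOf
  exact inv_le_one_of_one_le₀ (one_le_pow₀ (by linarith [(Nat.cast_nonneg ℓ : (0 : ℝ) ≤ ℓ)]))

/-- kernel: `ξ·n = 1` with `n = L^k` the number of fine points per unit block. [cite: Balaban1983Higgs3, (3.16) p.437] -/
theorem xiOf_mul_n (ℓ k : ℕ) : xiOf ℓ k * (((ℓ + 1) ^ k : ℕ) : ℝ) = 1 := by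
  unfold xiOf
  rw [show (((ℓ + 1) ^ k : ℕ) : ℝ) = ((ℓ : ℝ) + 1) ^ k by push_cast; ring]
  exact inv_mul_cancel₀ (by positivity)

/-- kernel: `n = ξ^{−1}`. [cite: Balaban1983Higgs3, (3.16) p.437] -/
theorem n_eq_inv_xiOf (ℓ k : ℕ) : (((ℓ + 1) ^ k : ℕ) : ℝ) = (xiOf ℓ k)⁻¹ := by
  rw [xiOf, inv_inv]; push_cast; ring

/-- kernel: `L^k = ξ^{−1}` (real form). [cite: Balaban1983Higgs3, (3.16) p.437] -/
theorem Lpow_eq_inv_xiOf (ℓ k : ℕ) : ((ℓ : ℝ) + 1) ^ k = (xiOf ℓ k)⁻¹ := by rw [xiOf, inv_inv]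

/-- `G^ξ_k(0)` is symmetric. [cite: Balaban1983Higgs3, (3.16) p.437] -/
theorem GxiL_comm (y y' : ZSite 3) : GxiL ℓ k a m2 y y' = GxiL ℓ k a m2 y' y := by
  unfold GxiL; rw [GkLat_comm]

/-- `M` is symmetric. [cite: Balaban1983Higgs3, (3.16) p.437] -/
theorem MxiL_comm (y y' : ZSite 3) : MxiL ℓ k a m2 y y' = MxiL ℓ k a m2 y' y := by
  unfold MxiL; rw [GxiL_comm, ← B3Sect3VectorSelfEnergy.Cxi_neg, neg_sub]

end Basic

/-! ## §2 The two lattice equations -/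

section Green

variable {ℓ k : ℕ} {a m2 : ℝ}

/-- kernel: a site is not its own nearest neighbour. [cite: Balaban1983Higgs3, (3.16) p.437] -/
theorem not_mem_nbrs_self (x : ZSite 3) : x ∉ B4Reflection242.nbrs (d := 2) x := by
  intro h
  obtain ⟨i, h | h⟩ := mem_nbrs.1 h
  · have := congr_fun h i; simp at this
  · have := congr_fun h i; simp at this; omega

/-- kernel: the sum over the nearest neighbours is the sum over the `2·3` shifted points. [cite: Balaban1983Higgs3, (3.16) p.437] -/
theorem sum_nbrs_eq (f : ZSite 3 → ℝ) (x : ZSite 3) :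
    ∑ z ∈ B4Reflection242.nbrs (d := 2) x, f z = ∑ μ : Fin 3, f (x + unitVec μ) + ∑ μ : Fin 3, f (x - unitVec μ) := by
  have hinj₁ : Function.Injective fun i : Fin 3 => x + Pi.single i (1 : ℤ) := by
    intro i j h
    have h' : Pi.single (M := fun _ : Fin 3 => ℤ) i 1 = Pi.single j 1 := add_left_cancel h
    by_contra hij
    have := congr_fun h' i
    simp [hij] at this
  have hinj₂ : Function.Injective fun i : Fin 3 => x - Pi.single i (1 : ℤ) := by
    intro i j h
    have h' : Pi.single (M := fun _ : Fin 3 => ℤ) i 1 = Pi.single j 1 := sub_right_injective h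
    by_contra hij
    have := congr_fun h' i
    simp [hij] at this
  have hdisj : Disjoint (Finset.univ.image fun i : Fin 3 => x + Pi.single i (1 : ℤ))
      (Finset.univ.image fun i : Fin 3 => x - Pi.single i (1 : ℤ)) := by
    rw [Finset.disjoint_left]
    intro z hz hz'
    rw [Finset.mem_image] at hz hz'
    obtain ⟨i, -, rfl⟩ := hz
    obtain ⟨j, -, hj⟩ := hz'
    have h' : -Pi.single (M := fun _ : Fin 3 => ℤ) j 1 = Pi.single i 1 := by
      have := hj; rw [sub_eq_add_neg] at this; exact add_left_cancel this
    have := congr_fun h' i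
    by_cases hij : j = i
    · subst hij; simp at this
    · simp [Ne.symm hij] at this
  unfold B4Reflection242.nbrs
  rw [Finset.sum_union hdisj, Finset.sum_image fun i _ j _ h => hinj₁ h, Finset.sum_image fun i _ j _ h => hinj₂ h]
  rfl

/-- **The row of the lattice operator, expanded**: `Σ_{z} H(x,z)f(z) = n²Σ_μ(2f(x) − f(x+e_μ) − f(x−e_μ)) + m²f(x) +
(A/n³)·Σ_{z ∈ block(x)} f(z)` for p03's `latOpK n A m² = n²(−Δ) + m² + (A/n³)1_{same block}` (`n ≥ 1`; the row is
supported in `opSupp n x`). [cite: Balaban1983Higgs3, (3.16) p.437] -/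
theorem sum_opSupp_latOpK_mul {n : ℕ} (hn : 1 ≤ n) (A m2 : ℝ) (f : ZSite 3 → ℝ) (x : ZSite 3) :
    ∑ z ∈ B4Reflection242.opSupp (d := 2) n x, latOpK (d := 2) n A m2 x z * f z =
      (n : ℝ) ^ 2 * ∑ μ : Fin 3, (2 * f x - f (x + unitVec μ) - f (x - unitVec μ)) + m2 * f x +
        A * ((n : ℝ) ^ 3)⁻¹ * ∑ z ∈ B4Reflection242.blockOf (d := 2) n x, f z := by
  have hxS : x ∈ B4Reflection242.opSupp (d := 2) n x := Finset.mem_union_left _ (Finset.mem_insert_self x _)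
  have hnb : B4Reflection242.nbrs (d := 2) x ⊆ B4Reflection242.opSupp (d := 2) n x :=
    (Finset.subset_insert x _).trans Finset.subset_union_left
  have hbl : B4Reflection242.blockOf (d := 2) n x ⊆ B4Reflection242.opSupp (d := 2) n x := Finset.subset_union_right
  -- split the kernel
  have hsplit : ∀ z, latOpK (d := 2) n A m2 x z * f z =
      (n : ℝ) ^ 2 * (B4Reflection242.lapK (d := 2) (R := ℝ) x z * f z) + (B4Reflection242.diagK (d := 2) m2 x z * f z +
        B4Reflection242.avgK (d := 2) (A * (((n : ℝ)) ^ (2 + 1))⁻¹) n x z * f z) := by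
    intro z; unfold latOpK; ring
  rw [Finset.sum_congr rfl fun z _ => hsplit z, Finset.sum_add_distrib, Finset.sum_add_distrib, ← Finset.mul_sum]
  -- the diagonal part
  have hdiag : ∑ z ∈ B4Reflection242.opSupp (d := 2) n x, B4Reflection242.diagK (d := 2) m2 x z * f z = m2 * f x := by
    have : ∀ z, B4Reflection242.diagK (d := 2) m2 x z * f z = if z = x then m2 * f z else 0 := by
      intro z; unfold B4Reflection242.diagK; split_ifs <;> simp
    rw [Finset.sum_congr rfl fun z _ => this z, Finset.sum_ite_eq' (B4Reflection242.opSupp (d := 2) n x) x, if_pos hxS]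
  -- the block part
  have havg : ∑ z ∈ B4Reflection242.opSupp (d := 2) n x, B4Reflection242.avgK (d := 2) (A * (((n : ℝ)) ^ (2 + 1))⁻¹) n x z * f z =
      A * ((n : ℝ) ^ 3)⁻¹ * ∑ z ∈ B4Reflection242.blockOf (d := 2) n x, f z := by
    have : ∀ z, B4Reflection242.avgK (d := 2) (A * (((n : ℝ)) ^ (2 + 1))⁻¹) n x z * f z =
        if blk n z = blk n x then A * ((n : ℝ) ^ 3)⁻¹ * f z else 0 := by
      intro z; unfold B4Reflection242.avgK; split_ifs <;> simp
    rw [Finset.sum_congr rfl fun z _ => this z, ← Finset.sum_filter, Finset.mul_sum]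
    congr 1
    ext z
    simp only [Finset.mem_filter, mem_blockOf hn]
    exact ⟨fun h => h.2, fun h => ⟨hbl ((mem_blockOf hn).2 h), h⟩⟩
  -- the Laplacian part
  have hlap : ∑ z ∈ B4Reflection242.opSupp (d := 2) n x, B4Reflection242.lapK (d := 2) (R := ℝ) x z * f z =
      ∑ μ : Fin 3, (2 * f x - f (x + unitVec μ) - f (x - unitVec μ)) := by
    have : ∀ z, B4Reflection242.lapK (d := 2) (R := ℝ) x z * f z =
        (if z = x then 6 * f z else 0) + (if z ∈ B4Reflection242.nbrs (d := 2) x then -f z else 0) := by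
      intro z; unfold B4Reflection242.lapK
      by_cases hzx : z = x
      · rw [if_pos hzx, if_pos hzx, if_neg (hzx ▸ not_mem_nbrs_self x)]; push_cast; ring
      · rw [if_neg hzx, if_neg hzx]
        split_ifs <;> ring
    rw [Finset.sum_congr rfl fun z _ => this z, Finset.sum_add_distrib, Finset.sum_ite_eq' (B4Reflection242.opSupp (d := 2) n x) x,
      if_pos hxS, ← Finset.sum_filter, Finset.filter_mem_eq_inter, Finset.inter_eq_right.2 hnb, sum_nbrs_eq]
    simp only [Finset.sum_neg_distrib]
    have h3 : ∑ μ : Fin 3, (2 * f x - f (x + unitVec μ) - f (x - unitVec μ)) =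
        6 * f x - (∑ μ : Fin 3, f (x + unitVec μ) + ∑ μ : Fin 3, f (x - unitVec μ)) := by
      rw [Finset.sum_sub_distrib, Finset.sum_sub_distrib, Finset.sum_const, Finset.card_univ, Fintype.card_fin]
      simp only [nsmul_eq_mul]; push_cast; ring
    rw [h3]; ring
  rw [hdiag, havg, hlap]
  ring

/-- **THE LATTICE EQUATION OF G^ξ_k(0)** — the infinite-lattice zero-field propagator of p. 433 (*"we substitute G_k(□,0) =
G_k(0) + δG_k(□,ηZ^d,0)"*), the operator `(−Δ^ξ + m²_{j″} + a_{j″}P_{j″})^{−1}` rescaled to ξℤ³ as in the p. 437 passage preceding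
(3.16): `(−Δ^ξ G^ξ(y,·))(x) + m²G^ξ(y,x) + a_k(P_k G^ξ(y,·))(x) = δ^ξ_y(x) = ξ^{−3}·1_{x = y}` for all `x, y` (p03's `green_GkLat`,
the row of the operator expanded, symmetry of `GkLat`); `k ≥ 1`, `0 < a`, `0 ≤ m²`. [cite: Balaban1983Higgs3, (3.16) p.437] -/
theorem green_GxiL (hℓ : 1 ≤ ℓ) (hk : 1 ≤ k) (ha : 0 < a) (hm : 0 ≤ m2) (y x : ZSite 3) :
    negLapZ (xiOf ℓ k) (GxiL ℓ k a m2 y) x + m2 * GxiL ℓ k a m2 y x +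
        B1.aSeq a ((ℓ : ℝ) + 1) k * blockAvg ℓ k (GxiL ℓ k a m2 y) x
      = if x = y then (xiOf ℓ k)⁻¹ ^ 3 else 0 := by
  set n : ℕ := (ℓ + 1) ^ k with hndef
  have hn : 1 ≤ n := Nat.one_le_pow _ _ (by omega)
  have hnr : (n : ℝ) = (xiOf ℓ k)⁻¹ := n_eq_inv_xiOf ℓ k
  have hnpos : (0 : ℝ) < n := by rw [hnr]; exact inv_pos.2 (xiOf_pos ℓ k)
  have hG := green_GkLat (d := 2) hℓ hk ha hm x y
  rw [sum_opSupp_latOpK_mul hn] at hG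
  -- multiply by `n³`
  have hG3 := congrArg (fun t => (n : ℝ) ^ 3 * t) hG
  have hL : ((ℓ : ℝ) + 1) ^ k = n := by rw [hndef]; push_cast; ring
  have hGx : ∀ z, GxiL ℓ k a m2 y z = (n : ℝ) ^ 3 * GkLat (d := 2) ℓ k a m2 z y := by
    intro z; rw [GxiL, hL, GkLat_comm]
  -- rewrite every term
  have e1 : negLapZ (xiOf ℓ k) (GxiL ℓ k a m2 y) x =
      (n : ℝ) ^ 3 * ((n : ℝ) ^ 2 * ∑ μ : Fin 3, (2 * GkLat (d := 2) ℓ k a m2 x y -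
        GkLat (d := 2) ℓ k a m2 (x + unitVec μ) y - GkLat (d := 2) ℓ k a m2 (x - unitVec μ) y)) := by
    unfold negLapZ
    simp only [hGx, ← hnr, Finset.mul_sum]
    refine Finset.sum_congr rfl fun μ _ => ?_
    ring
  have e2 : blockAvg ℓ k (GxiL ℓ k a m2 y) x = ∑ z ∈ B4Reflection242.blockOf (d := 2) n x, GkLat (d := 2) ℓ k a m2 z y := by
    unfold blockAvg
    rw [← hndef]
    refine Finset.sum_congr rfl fun z _ => ?_
    rw [hGx, xiOf, hL, ← mul_assoc, ← mul_pow, inv_mul_cancel₀ hnpos.ne', one_pow, one_mul]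
  rw [e1, e2, hGx x]
  have e3 : (if x = y then (xiOf ℓ k)⁻¹ ^ 3 else (0 : ℝ)) = (n : ℝ) ^ 3 * (if x = y then 1 else 0) := by
    rw [← hnr]; split_ifs <;> ring
  rw [e3, ← hG3]
  have hn0 : (n : ℝ) ≠ 0 := hnpos.ne'
  field_simp

/-- **THE LATTICE EQUATION OF C^ξ**, translated: `(−Δ^ξ + 1)C^ξ(· − y′) = δ^ξ_{y′}` on ℤ³ (r15's `negLapZ_Cxi_add`).
[cite: Balaban1983Higgs3, (3.16) p.437] -/
theorem green_Cxi_translate {ξ : ℝ} (hξ : 0 < ξ) (y' x : ZSite 3) :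
    negLapZ ξ (fun z => Cxi 3 ξ (z - y')) x + Cxi 3 ξ (x - y') = if x = y' then ξ⁻¹ ^ 3 else 0 := by
  have h := negLapZ_Cxi_add (d := 3) hξ (x - y')
  have e : negLapZ ξ (fun z => Cxi 3 ξ (z - y')) x = negLapZ ξ (Cxi 3 ξ) (x - y') := by
    unfold negLapZ
    refine Finset.sum_congr rfl fun μ _ => ?_
    simp only [add_sub_right_comm x (unitVec μ) y', sub_right_comm x (unitVec μ) y']
  rw [e, h]
  simp only [sub_eq_zero]

end Green

/-! ## §3 Model-free: summation by parts for `−Δ^ξ` on ℤ³ -/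

section Parts

/-- kernel: an absolutely summable function is bounded by its `ℓ¹` norm. [cite: Balaban1983Higgs3, (3.16) p.437] -/
theorem abs_le_tsum_abs {f : ZSite 3 → ℝ} (hf : Summable fun z => |f z|) (z : ZSite 3) : |f z| ≤ ∑' w, |f w| :=
  hf.le_tsum z (fun _ _ => abs_nonneg _)

/-- kernel: (absolutely summable) × (bounded) is absolutely summable. [cite: Balaban1983Higgs3, (3.16) p.437] -/
theorem summable_abs_mul_of_bdd {f g : ZSite 3 → ℝ} {B : ℝ} (hf : Summable fun z => |f z|) (hg : ∀ z, |g z| ≤ B) :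
    Summable fun z => |f z * g z| := by
  refine Summable.of_nonneg_of_le (fun z => abs_nonneg _) (fun z => ?_) (hf.mul_right B)
  rw [abs_mul]
  exact mul_le_mul_of_nonneg_left (hg z) (abs_nonneg _)

/-- kernel: (absolutely summable) × (bounded) is summable. [cite: Balaban1983Higgs3, (3.16) p.437] -/
theorem summable_mul_of_bdd {f g : ZSite 3 → ℝ} {B : ℝ} (hf : Summable fun z => |f z|) (hg : ∀ z, |g z| ≤ B) :
    Summable fun z => f z * g z :=
  (summable_abs_mul_of_bdd hf hg).of_abs

/-- kernel: (bounded) × (absolutely summable) is summable. [cite: Balaban1983Higgs3, (3.16) p.437] -/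
theorem summable_bdd_mul {f g : ZSite 3 → ℝ} {B : ℝ} (hf : ∀ z, |f z| ≤ B) (hg : Summable fun z => |g z|) :
    Summable fun z => f z * g z := by
  have h := summable_mul_of_bdd hg hf
  simpa only [mul_comm] using h

/-- kernel: a translate of an absolutely summable function is absolutely summable. [cite: Balaban1983Higgs3, (3.16) p.437] -/
theorem summable_abs_translate {f : ZSite 3 → ℝ} (hf : Summable fun z => |f z|) (v : ZSite 3) :
    Summable fun z => |f (z + v)| :=
  (Equiv.addRight v).summable_iff.2 hf

/-- kernel: `−Δ^ξ` of a bounded function is bounded. [cite: Balaban1983Higgs3, (3.16) p.437] -/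
theorem abs_negLapZ_le_of_bdd {g : ZSite 3 → ℝ} {B : ℝ} (hg : ∀ z, |g z| ≤ B) (ξ : ℝ) (z : ZSite 3) :
    |negLapZ ξ g z| ≤ 3 * (ξ⁻¹ ^ 2 * (4 * B)) := by
  unfold negLapZ
  calc |∑ μ : Fin 3, ξ⁻¹ ^ 2 * (2 * g z - g (z + unitVec μ) - g (z - unitVec μ))|
      ≤ ∑ μ : Fin 3, |ξ⁻¹ ^ 2 * (2 * g z - g (z + unitVec μ) - g (z - unitVec μ))| := Finset.abs_sum_le_sum_abs _ _
    _ ≤ ∑ _μ : Fin 3, ξ⁻¹ ^ 2 * (4 * B) := by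
        refine Finset.sum_le_sum fun μ _ => ?_
        rw [abs_mul, abs_of_nonneg (by positivity : (0 : ℝ) ≤ ξ⁻¹ ^ 2)]
        refine mul_le_mul_of_nonneg_left ?_ (by positivity)
        have h1 := hg z; have h2 := hg (z + unitVec μ); have h3 := hg (z - unitVec μ)
        calc |2 * g z - g (z + unitVec μ) - g (z - unitVec μ)|
            ≤ |2 * g z - g (z + unitVec μ)| + |g (z - unitVec μ)| := abs_sub _ _
          _ ≤ (|2 * g z| + |g (z + unitVec μ)|) + |g (z - unitVec μ)| := by gcongr; exact abs_sub _ _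
          _ ≤ (2 * B + B) + B := by rw [abs_mul, abs_two]; gcongr
          _ = 4 * B := by ring
    _ = 3 * (ξ⁻¹ ^ 2 * (4 * B)) := by rw [Finset.sum_const, Finset.card_univ, Fintype.card_fin]; simp

/-- **Summation by parts for `−Δ^ξ` on ℤ³**: `Σ'_z f(z)(−Δ^ξg)(z) = Σ'_z (−Δ^ξf)(z)g(z)` for absolutely summable `f, g`
(every shifted product is summable; the shifts are re-indexed by lattice translations). [cite: Balaban1983Higgs3, (3.16) p.437] -/
theorem tsum_mul_negLapZ_comm {f g : ZSite 3 → ℝ} (hf : Summable fun z => |f z|) (hg : Summable fun z => |g z|) (ξ : ℝ) :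
    ∑' z, f z * negLapZ ξ g z = ∑' z, negLapZ ξ f z * g z := by
  set Bf : ℝ := ∑' w, |f w|
  set Bg : ℝ := ∑' w, |g w|
  have hBf : ∀ z, |f z| ≤ Bf := abs_le_tsum_abs hf
  have hBg : ∀ z, |g z| ≤ Bg := abs_le_tsum_abs hg
  set c : ℝ := ξ⁻¹ ^ 2
  -- summable pieces
  have s0 : Summable fun z => f z * g z := summable_mul_of_bdd hf hBg
  have sP : ∀ μ : Fin 3, Summable fun z => f z * g (z + unitVec μ) :=
    fun μ => summable_mul_of_bdd hf (fun z => hBg _)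
  have sM : ∀ μ : Fin 3, Summable fun z => f z * g (z - unitVec μ) :=
    fun μ => summable_mul_of_bdd hf (fun z => hBg _)
  have sP' : ∀ μ : Fin 3, Summable fun z => f (z + unitVec μ) * g z :=
    fun μ => summable_bdd_mul (fun z => hBf _) hg
  have sM' : ∀ μ : Fin 3, Summable fun z => f (z - unitVec μ) * g z :=
    fun μ => summable_bdd_mul (fun z => hBf _) hg
  -- the shifted products re-indexed
  have rP : ∀ μ : Fin 3, ∑' z, f z * g (z + unitVec μ) = ∑' z, f (z - unitVec μ) * g z := by
    intro μ
    rw [← (Equiv.subRight (unitVec μ)).tsum_eq (fun z => f z * g (z + unitVec μ))]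
    simp only [Equiv.subRight_apply, sub_add_cancel]
  have rM : ∀ μ : Fin 3, ∑' z, f z * g (z - unitVec μ) = ∑' z, f (z + unitVec μ) * g z := by
    intro μ
    rw [← (Equiv.addRight (unitVec μ)).tsum_eq (fun z => f z * g (z - unitVec μ))]
    simp only [Equiv.coe_addRight, add_sub_cancel_right]
  -- expand both sides as finite sums of summable series
  have hL : ∀ z, f z * negLapZ ξ g z =
      ∑ μ : Fin 3, (c * (2 * (f z * g z)) - c * (f z * g (z + unitVec μ)) - c * (f z * g (z - unitVec μ))) := by
    intro z; unfold negLapZ; rw [Finset.mul_sum]; refine Finset.sum_congr rfl fun μ _ => ?_; ring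
  have hR : ∀ z, negLapZ ξ f z * g z =
      ∑ μ : Fin 3, (c * (2 * (f z * g z)) - c * (f (z - unitVec μ) * g z) - c * (f (z + unitVec μ) * g z)) := by
    intro z; unfold negLapZ; rw [Finset.sum_mul]; refine Finset.sum_congr rfl fun μ _ => ?_; ring
  simp_rw [hL, hR]
  have sL : ∀ μ : Fin 3, Summable fun z =>
      c * (2 * (f z * g z)) - c * (f z * g (z + unitVec μ)) - c * (f z * g (z - unitVec μ)) :=
    fun μ => (((s0.mul_left 2).mul_left c).sub ((sP μ).mul_left c)).sub ((sM μ).mul_left c)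
  have sR : ∀ μ : Fin 3, Summable fun z =>
      c * (2 * (f z * g z)) - c * (f (z - unitVec μ) * g z) - c * (f (z + unitVec μ) * g z) :=
    fun μ => (((s0.mul_left 2).mul_left c).sub ((sM' μ).mul_left c)).sub ((sP' μ).mul_left c)
  rw [Summable.tsum_finsetSum (fun μ _ => sL μ), Summable.tsum_finsetSum (fun μ _ => sR μ)]
  refine Finset.sum_congr rfl fun μ _ => ?_
  rw [(((s0.mul_left 2).mul_left c).sub ((sP μ).mul_left c)).tsum_sub ((sM μ).mul_left c),
    ((s0.mul_left 2).mul_left c).tsum_sub ((sP μ).mul_left c),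
    (((s0.mul_left 2).mul_left c).sub ((sM' μ).mul_left c)).tsum_sub ((sP' μ).mul_left c),
    ((s0.mul_left 2).mul_left c).tsum_sub ((sM' μ).mul_left c),
    (sP μ).tsum_mul_left c, (sM μ).tsum_mul_left c, (sM' μ).tsum_mul_left c, (sP' μ).tsum_mul_left c, rP μ, rM μ]

end Parts

/-! ## §4 The resolvent identity (p. 437, the unlabelled display preceding (3.16)) -/

section Resolvent

/-- **The resolvent identity (p. 437, display preceding (3.16)), abstract form**: if `g` solves `(−Δ^ξ + m² + a·P)g = δ^ξ_y`
and `c` solves `(−Δ^ξ + 1)c = δ^ξ_{y′}` on ℤ³ (block averaging `(Pg)(x) = Σ_{z′ ∈ block(x)} ξ³g(z′)`, `δ^ξ_y = ξ^{−3}1_y`), both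
absolutely summable, then `g(y′) − c(y) = Σ'_z ξ³·[(1 − m²)g(z) − a(Pg)(z)]·c(z)` — the two Green identities paired against each
other and summation by parts. [cite: Balaban1983Higgs3, (3.16) p.437] -/
theorem hasSum_resolvent_of_equations {ξ m2 ak : ℝ} (hξ : ξ ≠ 0) {n : ℕ} {g c : ZSite 3 → ℝ} {y y' : ZSite 3}
    (hg_eq : ∀ x, negLapZ ξ g x + m2 * g x + ak * (∑ z' ∈ B4Reflection242.blockOf (d := 2) n x, ξ ^ 3 * g z') =
      if x = y then ξ⁻¹ ^ 3 else 0)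
    (hc_eq : ∀ x, negLapZ ξ c x + c x = if x = y' then ξ⁻¹ ^ 3 else 0)
    (hg : Summable fun z => |g z|) (hc : Summable fun z => |c z|) :
    HasSum (fun z => ξ ^ 3 * (((1 - m2) * g z - ak * ∑ z' ∈ B4Reflection242.blockOf (d := 2) n z, ξ ^ 3 * g z') * c z))
      (g y' - c y) := by
  set Bg : ℝ := ∑' w, |g w|
  set Bc : ℝ := ∑' w, |c w|
  have hBg : ∀ z, |g z| ≤ Bg := abs_le_tsum_abs hg
  have hBc : ∀ z, |c z| ≤ Bc := abs_le_tsum_abs hc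
  set P : ZSite 3 → ℝ := fun z => ∑ z' ∈ B4Reflection242.blockOf (d := 2) n z, ξ ^ 3 * g z' with hP
  -- bounds
  have hPb : ∀ z, |P z| ≤ |ξ ^ 3| * Bg := by
    intro z
    calc |P z| ≤ ∑ z' ∈ B4Reflection242.blockOf (d := 2) n z, |ξ ^ 3 * g z'| := Finset.abs_sum_le_sum_abs _ _
      _ = |ξ ^ 3| * ∑ z' ∈ B4Reflection242.blockOf (d := 2) n z, |g z'| := by
          rw [Finset.mul_sum]; refine Finset.sum_congr rfl fun z' _ => abs_mul _ _
      _ ≤ |ξ ^ 3| * Bg := by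
          refine mul_le_mul_of_nonneg_left ?_ (abs_nonneg _)
          exact hg.sum_le_tsum _ (fun w _ => abs_nonneg _)
  have hLc : ∀ z, |negLapZ ξ c z| ≤ 3 * (ξ⁻¹ ^ 2 * (4 * Bc)) := abs_negLapZ_le_of_bdd hBc ξ
  have hLg : ∀ z, |negLapZ ξ g z| ≤ 3 * (ξ⁻¹ ^ 2 * (4 * Bg)) := abs_negLapZ_le_of_bdd hBg ξ
  -- summable pieces
  have s_gc : Summable fun z => g z * c z := summable_mul_of_bdd hg hBc
  have s_gLc : Summable fun z => g z * negLapZ ξ c z := summable_mul_of_bdd hg hLc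
  have s_Lgc : Summable fun z => negLapZ ξ g z * c z := summable_bdd_mul hLg hc
  have s_Pc : Summable fun z => P z * c z := summable_bdd_mul hPb hc
  -- (A) pairing the `c`-equation with `g`
  have hA : ∑' z, ξ ^ 3 * (g z * negLapZ ξ c z) + ∑' z, ξ ^ 3 * (g z * c z) = g y' := by
    rw [← (s_gLc.mul_left _).tsum_add (s_gc.mul_left _)]
    have : ∀ z, ξ ^ 3 * (g z * negLapZ ξ c z) + ξ ^ 3 * (g z * c z) = if z = y' then g z else 0 := by
      intro z
      rw [← mul_add, ← mul_add, hc_eq z]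
      split_ifs with h
      · field_simp
      · simp
    simp_rw [this]
    rw [tsum_eq_single y' (fun z hz => if_neg hz), if_pos rfl]
  -- (B) pairing the `g`-equation with `c`
  have hB : ∑' z, ξ ^ 3 * (negLapZ ξ g z * c z) + m2 * ∑' z, ξ ^ 3 * (g z * c z) + ak * ∑' z, ξ ^ 3 * (P z * c z)
      = c y := by
    rw [← (s_gc.mul_left (ξ ^ 3)).tsum_mul_left m2, ← (s_Pc.mul_left (ξ ^ 3)).tsum_mul_left ak,
      ← (s_Lgc.mul_left _).tsum_add ((s_gc.mul_left _).mul_left m2),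
      ← ((s_Lgc.mul_left _).add ((s_gc.mul_left _).mul_left m2)).tsum_add ((s_Pc.mul_left _).mul_left ak)]
    have : ∀ z, ξ ^ 3 * (negLapZ ξ g z * c z) + m2 * (ξ ^ 3 * (g z * c z)) + ak * (ξ ^ 3 * (P z * c z)) =
        if z = y then c z else 0 := by
      intro z
      have e : ξ ^ 3 * (negLapZ ξ g z * c z) + m2 * (ξ ^ 3 * (g z * c z)) + ak * (ξ ^ 3 * (P z * c z)) =
          ξ ^ 3 * c z * (negLapZ ξ g z + m2 * g z + ak * P z) := by simp only [hP]; ring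
      rw [e, hg_eq z]
      split_ifs with h
      · field_simp
      · simp
    simp_rw [this]
    rw [tsum_eq_single y (fun z hz => if_neg hz), if_pos rfl]
  -- (C) summation by parts
  have hC : ∑' z, ξ ^ 3 * (g z * negLapZ ξ c z) = ∑' z, ξ ^ 3 * (negLapZ ξ g z * c z) := by
    rw [tsum_mul_left, tsum_mul_left, tsum_mul_negLapZ_comm hg hc]
  -- assemble
  have s_main : Summable fun z => ξ ^ 3 * (((1 - m2) * g z - ak * P z) * c z) := by
    have : ∀ z, ξ ^ 3 * (((1 - m2) * g z - ak * P z) * c z) =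
        (1 - m2) * (ξ ^ 3 * (g z * c z)) - ak * (ξ ^ 3 * (P z * c z)) := fun z => by ring
    simp_rw [this]
    exact ((s_gc.mul_left _).mul_left _).sub ((s_Pc.mul_left _).mul_left _)
  have hval : ∑' z, ξ ^ 3 * (((1 - m2) * g z - ak * P z) * c z) = g y' - c y := by
    have : ∀ z, ξ ^ 3 * (((1 - m2) * g z - ak * P z) * c z) =
        (1 - m2) * (ξ ^ 3 * (g z * c z)) - ak * (ξ ^ 3 * (P z * c z)) := fun z => by ring
    simp_rw [this]
    rw [((s_gc.mul_left _).mul_left _).tsum_sub ((s_Pc.mul_left _).mul_left _),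
      (s_gc.mul_left (ξ ^ 3)).tsum_mul_left (1 - m2), (s_Pc.mul_left (ξ ^ 3)).tsum_mul_left ak, ← hA, ← hB, hC]
    ring
  rw [← hval]
  exact s_main.hasSum

end Resolvent

/-! ## §5 Kernel laws of the pieces -/

section Profiles

variable {ℓ k : ℕ} {a m2 : ℝ}

/-- kernel: the profile of `B3GkZeroLatticePointwise` (ℝ-valued sup norm, `÷ L^k`) is the profile of `B3ZdLatticeProfileSums`
(ℕ-valued sup norm, `× ξ`). [cite: Balaban1983Higgs3, (3.16) p.437] -/
theorem profile_conv (ℓ k q : ℕ) (δ : ℝ) (u : ZSite 3) :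
    (max 1 (B4ContourShift.supNorm (d := 2) u) / ((ℓ : ℝ) + 1) ^ k)⁻¹ ^ q *
        Real.exp (-(δ * (B4ContourShift.supNorm (d := 2) u / ((ℓ : ℝ) + 1) ^ k))) =
      ((xiOf ℓ k * max 1 (supNorm u : ℝ)) ^ q)⁻¹ * Real.exp (-(δ * (xiOf ℓ k * (supNorm u : ℝ)))) := by
  rw [← cast_supNorm_eq, xiOf, ← inv_pow, div_eq_mul_inv, div_eq_mul_inv, mul_comm (max 1 _) _,
    mul_comm (supNorm u : ℝ) _]

/-- kernel: weakening the rate of a profile. [cite: Balaban1983Higgs3, (3.16) p.437] -/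
theorem profile_rate_mono {ξ δ δ' : ℝ} (hξ : 0 ≤ ξ) (h : δ' ≤ δ) (q : ℕ) (u : ZSite 3) {C C' : ℝ} (hC : C ≤ C')
    (hC0 : 0 ≤ C') :
    C * (((ξ * max 1 (supNorm u : ℝ)) ^ q)⁻¹ * Real.exp (-(δ * (ξ * (supNorm u : ℝ))))) ≤
      C' * (((ξ * max 1 (supNorm u : ℝ)) ^ q)⁻¹ * Real.exp (-(δ' * (ξ * (supNorm u : ℝ))))) := by
  have hP := profile_mono_rate hξ h q u
  have hP0 : 0 ≤ ((ξ * max 1 (supNorm u : ℝ)) ^ q)⁻¹ * Real.exp (-(δ * (ξ * (supNorm u : ℝ)))) := by positivity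
  calc C * (((ξ * max 1 (supNorm u : ℝ)) ^ q)⁻¹ * Real.exp (-(δ * (ξ * (supNorm u : ℝ)))))
      ≤ C' * (((ξ * max 1 (supNorm u : ℝ)) ^ q)⁻¹ * Real.exp (-(δ * (ξ * (supNorm u : ℝ))))) :=
        mul_le_mul_of_nonneg_right hC hP0
    _ ≤ C' * (((ξ * max 1 (supNorm u : ℝ)) ^ q)⁻¹ * Real.exp (-(δ' * (ξ * (supNorm u : ℝ))))) :=
        mul_le_mul_of_nonneg_left hP hC0

/-- **THE KERNEL LAWS OF G^ξ_k(0) ON ξℤ³** (p. 437: *"|G^ξ_{j″}(0;y,y′)| ≦ O(1)e^{−δ₀|y−y′|}/|y − y′| and the corresponding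
inequalities for derivatives"*), all sites, one rate `0 < δ ≤ ½`, uniform in `k ≥ 1` and the window: `|G^ξ(y,z)| ≤ C·P₁^δ(y−z)`,
`ξ^{−1}|G^ξ(y+e_μ,z) − G^ξ(y,z)| ≤ C·P₂^δ(y−z)`, `ξ^{−1}|G^ξ(y,z+e_μ) − G^ξ(y,z)| ≤ C·P₂^δ(y−z)` (`B3GkZeroLatticePointwise`).
[cite: Balaban1983Higgs3, (3.16) p.437] -/
theorem exists_GxiL_profile (hℓ : 1 ≤ ℓ) (amin aplus m2plus : ℝ) (ha : 0 < amin) :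
    ∃ δ C : ℝ, 0 < δ ∧ δ ≤ 1 / 2 ∧ 0 < C ∧ ∀ (k : ℕ), 1 ≤ k → ∀ (a m2 : ℝ), amin ≤ a → a ≤ aplus → 0 ≤ m2 → m2 ≤ m2plus →
      (∀ y z : ZSite 3, |GxiL ℓ k a m2 y z| ≤
          C * (((xiOf ℓ k * max 1 (supNorm (y - z) : ℝ)) ^ 1)⁻¹ * Real.exp (-(δ * (xiOf ℓ k * (supNorm (y - z) : ℝ)))))) ∧
      (∀ (μ : Fin 3) (y z : ZSite 3), (xiOf ℓ k)⁻¹ * |GxiL ℓ k a m2 (y + unitVec μ) z - GxiL ℓ k a m2 y z| ≤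
          C * (((xiOf ℓ k * max 1 (supNorm (y - z) : ℝ)) ^ 2)⁻¹ * Real.exp (-(δ * (xiOf ℓ k * (supNorm (y - z) : ℝ)))))) ∧
      (∀ (μ : Fin 3) (y z : ZSite 3), (xiOf ℓ k)⁻¹ * |GxiL ℓ k a m2 y (z + unitVec μ) - GxiL ℓ k a m2 y z| ≤
          C * (((xiOf ℓ k * max 1 (supNorm (y - z) : ℝ)) ^ 2)⁻¹ * Real.exp (-(δ * (xiOf ℓ k * (supNorm (y - z) : ℝ)))))) := by
  obtain ⟨δ₁, C₁, hδ₁, hC₁, h₁⟩ := abs_GkLat_profile 2 ℓ le_rfl hℓ amin aplus m2plus ha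
  obtain ⟨δ₂, C₂, hδ₂, hC₂, h₂⟩ := abs_GkLatDiff_profile 2 ℓ le_rfl hℓ amin aplus m2plus ha
  obtain ⟨δ₃, C₃, hδ₃, hC₃, h₃⟩ := abs_GkLatDiff'_profile 2 ℓ le_rfl hℓ amin aplus m2plus ha
  set δ : ℝ := min (min δ₁ (min δ₂ δ₃)) (1 / 2) with hδdef
  set C : ℝ := max C₁ (max C₂ C₃) with hCdef
  have hδpos : 0 < δ := lt_min (lt_min hδ₁ (lt_min hδ₂ hδ₃)) (by norm_num)
  have hδle1 : δ ≤ δ₁ := (min_le_left _ _).trans (min_le_left _ _)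
  have hδle2 : δ ≤ δ₂ := (min_le_left _ _).trans ((min_le_right _ _).trans (min_le_left _ _))
  have hδle3 : δ ≤ δ₃ := (min_le_left _ _).trans ((min_le_right _ _).trans (min_le_right _ _))
  have hC1 : C₁ ≤ C := le_max_left _ _
  have hC2 : C₂ ≤ C := (le_max_left _ _).trans (le_max_right _ _)
  have hC3 : C₃ ≤ C := (le_max_right _ _).trans (le_max_right _ _)
  have hCpos : 0 < C := hC₁.trans_le hC1
  refine ⟨δ, C, hδpos, min_le_right _ _, hCpos, ?_⟩
  intro k hk a m2 ha1 ha2 hm1 hm2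
  have hξ0 : 0 ≤ xiOf ℓ k := (xiOf_pos ℓ k).le
  have hL3 : (((ℓ : ℝ) + 1) ^ k) ^ (2 + 1) = (xiOf ℓ k)⁻¹ ^ 3 := by rw [Lpow_eq_inv_xiOf]
  have hL1 : ((ℓ : ℝ) + 1) ^ k = (xiOf ℓ k)⁻¹ := Lpow_eq_inv_xiOf ℓ k
  have habsG : ∀ y z, |GxiL ℓ k a m2 y z| = (xiOf ℓ k)⁻¹ ^ 3 * |GkLat (d := 2) ℓ k a m2 y z| := by
    intro y z
    rw [GxiL, abs_mul, hL1, abs_of_nonneg (by positivity)]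
  refine ⟨fun y z => ?_, fun μ y z => ?_, fun μ y z => ?_⟩
  · have hb := h₁ k hk a m2 ha1 ha2 hm1 hm2 y z
    rw [mul_assoc, profile_conv ℓ k (2 - 1) δ₁ (y - z), hL3] at hb
    rw [habsG]
    exact hb.trans (profile_rate_mono hξ0 hδle1 1 (y - z) hC1 hCpos.le)
  · have hb := h₂ k hk a m2 ha1 ha2 hm1 hm2 μ y z
    rw [mul_assoc C₂, profile_conv ℓ k 2 δ₂ (y - z), hL3, hL1] at hb
    have e : (xiOf ℓ k)⁻¹ * |GxiL ℓ k a m2 (y + unitVec μ) z - GxiL ℓ k a m2 y z| =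
        (xiOf ℓ k)⁻¹ ^ 3 * ((xiOf ℓ k)⁻¹ *
          |GkLat (d := 2) ℓ k a m2 (y + Pi.single μ 1) z - GkLat (d := 2) ℓ k a m2 y z|) := by
      rw [GxiL, GxiL, ← mul_sub, abs_mul, hL1, abs_of_nonneg (by positivity)]
      simp only [unitVec]
      ring
    rw [e]
    exact hb.trans (profile_rate_mono hξ0 hδle2 2 (y - z) hC2 hCpos.le)
  · have hb := h₃ k hk a m2 ha1 ha2 hm1 hm2 μ y z
    rw [mul_assoc C₃, profile_conv ℓ k 2 δ₃ (y - z), hL3, hL1] at hb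
    have e : (xiOf ℓ k)⁻¹ * |GxiL ℓ k a m2 y (z + unitVec μ) - GxiL ℓ k a m2 y z| =
        (xiOf ℓ k)⁻¹ ^ 3 * ((xiOf ℓ k)⁻¹ *
          |GkLat (d := 2) ℓ k a m2 y (z + Pi.single μ 1) - GkLat (d := 2) ℓ k a m2 y z|) := by
      rw [GxiL, GxiL, ← mul_sub, abs_mul, hL1, abs_of_nonneg (by positivity)]
      simp only [unitVec]
      ring
    rw [e]
    exact hb.trans (profile_rate_mono hξ0 hδle3 2 (y - z) hC3 hCpos.le)

/-- kernel: the block sum of a profile of `y − z′` over the block of `z` is at most `2812e²` times the profile of `y − z`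
(`B3ZdKernelConvolutions.blockSum_profile_le`, oriented). [cite: Balaban1983Higgs3, (3.16) p.437] -/
theorem blockSum_profile_le' {δ : ℝ} (hδ0 : 0 ≤ δ) (hδ1 : δ ≤ 1) {q : ℕ} (hq : q ≤ 2) (ℓ k : ℕ) (y z : ZSite 3) :
    ∑ z' ∈ B4Reflection242.blockOf (d := 2) ((ℓ + 1) ^ k) z,
        (xiOf ℓ k) ^ 3 * (((xiOf ℓ k * max 1 (supNorm (y - z') : ℝ)) ^ q)⁻¹ *
          Real.exp (-(δ * (xiOf ℓ k * (supNorm (y - z') : ℝ))))) ≤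
      2812 * Real.exp 2 * (((xiOf ℓ k * max 1 (supNorm (y - z) : ℝ)) ^ q)⁻¹ *
        Real.exp (-(δ * (xiOf ℓ k * (supNorm (y - z) : ℝ))))) := by
  have hn : 1 ≤ (ℓ + 1) ^ k := Nat.one_le_pow _ _ (by omega)
  have h := blockSum_profile_le (xiOf_pos ℓ k) (xiOf_le_one ℓ k) hδ0 hδ1 hq (xiOf_mul_n ℓ k)
    (B4Reflection242.blockOf (d := 2) ((ℓ + 1) ^ k) z) z (fun z' hz' => supNorm_sub_lt_of_mem_blockOf hn hz')
    (card_blockOf _ z).le y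
  have e : ∀ w : ZSite 3, supNorm (y - w) = supNorm (w - y) := fun w => by rw [← supNorm_neg, neg_sub]
  simp only [e]
  exact h

/-- **THE KERNEL LAWS OF THE MIDDLE FACTOR** `[G^ξ_k(0)(1 − m² − a_kP_k)](y,z)` of (3.16): `|·| ≤ C·P₁^δ(y−z)` and
`ξ^{−1}|[·](y+e_μ,z) − [·](y,z)| ≤ C·P₂^δ(y−z)`, one rate `0 < δ ≤ ½`, uniform in `k ≥ 1` and the window — the laws of `G^ξ`
(`exists_GxiL_profile`), `|1 − m²| ≤ 1 + m²₊`, `0 < a_k ≤ a ≤ a₊` (`B1.aSeq_pos`, `B1.aSeq_le`), and the fact that block averaging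
preserves profiles (`B3ZdKernelConvolutions.blockSum_profile_le`). [cite: Balaban1983Higgs3, (3.16) p.437] -/
theorem exists_smearG_profile (hℓ : 1 ≤ ℓ) (amin aplus m2plus : ℝ) (ha : 0 < amin) :
    ∃ δ C : ℝ, 0 < δ ∧ δ ≤ 1 / 2 ∧ 0 < C ∧ ∀ (k : ℕ), 1 ≤ k → ∀ (a m2 : ℝ), amin ≤ a → a ≤ aplus → 0 ≤ m2 → m2 ≤ m2plus →
      (∀ y z : ZSite 3, |smearG ℓ k a m2 y z| ≤
          C * (((xiOf ℓ k * max 1 (supNorm (y - z) : ℝ)) ^ 1)⁻¹ * Real.exp (-(δ * (xiOf ℓ k * (supNorm (y - z) : ℝ)))))) ∧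
      (∀ (μ : Fin 3) (y z : ZSite 3), (xiOf ℓ k)⁻¹ * |smearG ℓ k a m2 (y + unitVec μ) z - smearG ℓ k a m2 y z| ≤
          C * (((xiOf ℓ k * max 1 (supNorm (y - z) : ℝ)) ^ 2)⁻¹ * Real.exp (-(δ * (xiOf ℓ k * (supNorm (y - z) : ℝ)))))) := by
  obtain ⟨δ, C, hδ, hδh, hC, h⟩ := exists_GxiL_profile hℓ amin aplus m2plus ha
  have hδ1 : δ ≤ 1 := hδh.trans (by norm_num)
  set K : ℝ := C * ((1 + |m2plus|) + |aplus| * (2812 * Real.exp 2)) with hKdef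
  have hKpos : 0 < K := by positivity
  refine ⟨δ, K, hδ, hδh, hKpos, ?_⟩
  intro k hk a m2 ha1 ha2 hm1 hm2
  obtain ⟨hG, hGd, -⟩ := h k hk a m2 ha1 ha2 hm1 hm2
  have hL : (1 : ℝ) < (ℓ : ℝ) + 1 := by
    have : (1 : ℝ) ≤ ℓ := by exact_mod_cast hℓ
    linarith
  have ha0 : 0 < a := ha.trans_le ha1
  have hak0 : 0 < B1.aSeq a ((ℓ : ℝ) + 1) k := B1.aSeq_pos ha0 hL hk
  have hak : B1.aSeq a ((ℓ : ℝ) + 1) k ≤ |aplus| := ((B1.aSeq_le ha0 hL k hk).trans ha2).trans (le_abs_self _)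
  have hm : |1 - m2| ≤ 1 + |m2plus| := by
    rw [abs_le]; constructor <;> nlinarith [le_abs_self m2plus, abs_nonneg m2plus]
  set ξ := xiOf ℓ k with hξdef
  have hξ0 : 0 ≤ ξ := (xiOf_pos ℓ k).le
  -- the two profiles
  set P1 : ZSite 3 → ℝ := fun u => ((ξ * max 1 (supNorm u : ℝ)) ^ 1)⁻¹ * Real.exp (-(δ * (ξ * (supNorm u : ℝ)))) with hP1
  set P2 : ZSite 3 → ℝ := fun u => ((ξ * max 1 (supNorm u : ℝ)) ^ 2)⁻¹ * Real.exp (-(δ * (ξ * (supNorm u : ℝ)))) with hP2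
  have hP10 : ∀ u, 0 ≤ P1 u := fun u => by positivity
  have hP20 : ∀ u, 0 ≤ P2 u := fun u => by positivity
  -- block sums of the laws of `G`
  have hB1 : ∀ y z, |blockAvg ℓ k (GxiL ℓ k a m2 y) z| ≤ C * (2812 * Real.exp 2) * P1 (y - z) := by
    intro y z
    unfold blockAvg
    calc |∑ z' ∈ B4Reflection242.blockOf (d := 2) ((ℓ + 1) ^ k) z, xiOf ℓ k ^ 3 * GxiL ℓ k a m2 y z'|
        ≤ ∑ z' ∈ B4Reflection242.blockOf (d := 2) ((ℓ + 1) ^ k) z, |xiOf ℓ k ^ 3 * GxiL ℓ k a m2 y z'| :=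
          Finset.abs_sum_le_sum_abs _ _
      _ ≤ ∑ z' ∈ B4Reflection242.blockOf (d := 2) ((ℓ + 1) ^ k) z, xiOf ℓ k ^ 3 * (C * P1 (y - z')) := by
          refine Finset.sum_le_sum fun z' _ => ?_
          rw [abs_mul, abs_of_nonneg (by positivity : (0 : ℝ) ≤ xiOf ℓ k ^ 3)]
          exact mul_le_mul_of_nonneg_left (hG y z') (by positivity)
      _ = C * ∑ z' ∈ B4Reflection242.blockOf (d := 2) ((ℓ + 1) ^ k) z, xiOf ℓ k ^ 3 * P1 (y - z') := by
          rw [Finset.mul_sum]; refine Finset.sum_congr rfl fun z' _ => ?_; ring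
      _ ≤ C * ((2812 * Real.exp 2) * P1 (y - z)) :=
          mul_le_mul_of_nonneg_left (blockSum_profile_le' hδ.le hδ1 (by norm_num) ℓ k y z) hC.le
      _ = C * (2812 * Real.exp 2) * P1 (y - z) := by ring
  have hB2 : ∀ μ y z, (xiOf ℓ k)⁻¹ * |blockAvg ℓ k (GxiL ℓ k a m2 (y + unitVec μ)) z - blockAvg ℓ k (GxiL ℓ k a m2 y) z|
      ≤ C * (2812 * Real.exp 2) * P2 (y - z) := by
    intro μ y z
    unfold blockAvg
    rw [← Finset.sum_sub_distrib]
    calc (xiOf ℓ k)⁻¹ * |∑ z' ∈ B4Reflection242.blockOf (d := 2) ((ℓ + 1) ^ k) z,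
          (xiOf ℓ k ^ 3 * GxiL ℓ k a m2 (y + unitVec μ) z' - xiOf ℓ k ^ 3 * GxiL ℓ k a m2 y z')|
        ≤ (xiOf ℓ k)⁻¹ * ∑ z' ∈ B4Reflection242.blockOf (d := 2) ((ℓ + 1) ^ k) z,
          |xiOf ℓ k ^ 3 * GxiL ℓ k a m2 (y + unitVec μ) z' - xiOf ℓ k ^ 3 * GxiL ℓ k a m2 y z'| :=
          mul_le_mul_of_nonneg_left (Finset.abs_sum_le_sum_abs _ _) (by positivity)
      _ = ∑ z' ∈ B4Reflection242.blockOf (d := 2) ((ℓ + 1) ^ k) z,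
          xiOf ℓ k ^ 3 * ((xiOf ℓ k)⁻¹ * |GxiL ℓ k a m2 (y + unitVec μ) z' - GxiL ℓ k a m2 y z'|) := by
          rw [Finset.mul_sum]; refine Finset.sum_congr rfl fun z' _ => ?_
          rw [← mul_sub, abs_mul, abs_of_nonneg (by positivity : (0 : ℝ) ≤ xiOf ℓ k ^ 3)]; ring
      _ ≤ ∑ z' ∈ B4Reflection242.blockOf (d := 2) ((ℓ + 1) ^ k) z, xiOf ℓ k ^ 3 * (C * P2 (y - z')) := by
          refine Finset.sum_le_sum fun z' _ => ?_
          exact mul_le_mul_of_nonneg_left (hGd μ y z') (by positivity)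
      _ = C * ∑ z' ∈ B4Reflection242.blockOf (d := 2) ((ℓ + 1) ^ k) z, xiOf ℓ k ^ 3 * P2 (y - z') := by
          rw [Finset.mul_sum]; refine Finset.sum_congr rfl fun z' _ => ?_; ring
      _ ≤ C * ((2812 * Real.exp 2) * P2 (y - z)) :=
          mul_le_mul_of_nonneg_left (blockSum_profile_le' hδ.le hδ1 le_rfl ℓ k y z) hC.le
      _ = C * (2812 * Real.exp 2) * P2 (y - z) := by ring
  refine ⟨fun y z => ?_, fun μ y z => ?_⟩
  · -- the value
    unfold smearG
    calc |(1 - m2) * GxiL ℓ k a m2 y z - B1.aSeq a ((ℓ : ℝ) + 1) k * blockAvg ℓ k (GxiL ℓ k a m2 y) z|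
        ≤ |(1 - m2) * GxiL ℓ k a m2 y z| + |B1.aSeq a ((ℓ : ℝ) + 1) k * blockAvg ℓ k (GxiL ℓ k a m2 y) z| :=
          abs_sub _ _
      _ = |1 - m2| * |GxiL ℓ k a m2 y z| + B1.aSeq a ((ℓ : ℝ) + 1) k * |blockAvg ℓ k (GxiL ℓ k a m2 y) z| := by
          rw [abs_mul, abs_mul, abs_of_pos hak0]
      _ ≤ (1 + |m2plus|) * (C * P1 (y - z)) + |aplus| * (C * (2812 * Real.exp 2) * P1 (y - z)) :=
          add_le_add (mul_le_mul hm (hG y z) (abs_nonneg _) (by positivity))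
            (mul_le_mul hak (hB1 y z) (abs_nonneg _) (abs_nonneg _))
      _ = K * P1 (y - z) := by rw [hKdef]; ring
  · -- the first difference in `y`
    unfold smearG
    have e : (1 - m2) * GxiL ℓ k a m2 (y + unitVec μ) z -
          B1.aSeq a ((ℓ : ℝ) + 1) k * blockAvg ℓ k (GxiL ℓ k a m2 (y + unitVec μ)) z -
        ((1 - m2) * GxiL ℓ k a m2 y z - B1.aSeq a ((ℓ : ℝ) + 1) k * blockAvg ℓ k (GxiL ℓ k a m2 y) z) =
        (1 - m2) * (GxiL ℓ k a m2 (y + unitVec μ) z - GxiL ℓ k a m2 y z) -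
          B1.aSeq a ((ℓ : ℝ) + 1) k *
            (blockAvg ℓ k (GxiL ℓ k a m2 (y + unitVec μ)) z - blockAvg ℓ k (GxiL ℓ k a m2 y) z) := by ring
    rw [e]
    calc (xiOf ℓ k)⁻¹ * |(1 - m2) * (GxiL ℓ k a m2 (y + unitVec μ) z - GxiL ℓ k a m2 y z) -
          B1.aSeq a ((ℓ : ℝ) + 1) k *
            (blockAvg ℓ k (GxiL ℓ k a m2 (y + unitVec μ)) z - blockAvg ℓ k (GxiL ℓ k a m2 y) z)|
        ≤ (xiOf ℓ k)⁻¹ * (|(1 - m2) * (GxiL ℓ k a m2 (y + unitVec μ) z - GxiL ℓ k a m2 y z)| +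
          |B1.aSeq a ((ℓ : ℝ) + 1) k *
            (blockAvg ℓ k (GxiL ℓ k a m2 (y + unitVec μ)) z - blockAvg ℓ k (GxiL ℓ k a m2 y) z)|) :=
          mul_le_mul_of_nonneg_left (abs_sub _ _) (by positivity)
      _ = |1 - m2| * ((xiOf ℓ k)⁻¹ * |GxiL ℓ k a m2 (y + unitVec μ) z - GxiL ℓ k a m2 y z|) +
          B1.aSeq a ((ℓ : ℝ) + 1) k * ((xiOf ℓ k)⁻¹ *
            |blockAvg ℓ k (GxiL ℓ k a m2 (y + unitVec μ)) z - blockAvg ℓ k (GxiL ℓ k a m2 y) z|) := by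
          rw [abs_mul, abs_mul, abs_of_pos hak0]; ring
      _ ≤ (1 + |m2plus|) * (C * P2 (y - z)) + |aplus| * (C * (2812 * Real.exp 2) * P2 (y - z)) :=
          add_le_add (mul_le_mul hm (hGd μ y z) (by positivity) (by positivity))
            (mul_le_mul hak (hB2 μ y z) (by positivity) (abs_nonneg _))
      _ = K * P2 (y - z) := by rw [hKdef]; ring

end Profiles

/-! ## §6 The resolvent identity (p. 437, display preceding (3.16)) for `G^ξ_k(0)` -/

section Concrete

variable {ℓ k : ℕ} {a m2 : ℝ}

/-- kernel: a profile of `y − z` is summable in `z` (without the volume factor). [cite: Balaban1983Higgs3, (3.16) p.437] -/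
theorem summable_profile_row {ξ δ : ℝ} (hξ : 0 < ξ) (hξ1 : ξ ≤ 1) (hδ : 0 < δ) (hδ1 : δ ≤ 1) {q : ℕ} (hq : q ≤ 2)
    (y : ZSite 3) :
    Summable fun z : ZSite 3 => ((ξ * max 1 (supNorm (y - z) : ℝ)) ^ q)⁻¹ * Real.exp (-(δ * (ξ * (supNorm (y - z) : ℝ)))) := by
  have h := ((tsum_profile_shift_le hξ hξ1 hδ hδ1 hq y y).1.1).mul_left ((ξ ^ 3)⁻¹)
  refine h.congr fun z => ?_
  rw [← mul_assoc, inv_mul_cancel₀ (by positivity), one_mul]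

/-- **The rows of `G^ξ_k(0)` are absolutely summable** (`k ≥ 1`, `0 < a`, `0 ≤ m²`). [cite: Balaban1983Higgs3, (3.16) p.437] -/
theorem summable_abs_GxiL (hℓ : 1 ≤ ℓ) (hk : 1 ≤ k) (ha : 0 < a) (hm : 0 ≤ m2) (y : ZSite 3) :
    Summable fun z => |GxiL ℓ k a m2 y z| := by
  obtain ⟨δ, C, hδ, hδh, hC, h⟩ := exists_GxiL_profile hℓ a a m2 ha
  obtain ⟨hG, -, -⟩ := h k hk a m2 le_rfl le_rfl hm le_rfl
  have hs := (summable_profile_row (xiOf_pos ℓ k) (xiOf_le_one ℓ k) hδ (hδh.trans (by norm_num)) (by norm_num : 1 ≤ 2)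
    y).mul_left C
  exact Summable.of_nonneg_of_le (fun z => abs_nonneg _) (fun z => hG y z) hs

/-- **The rows of the middle factor are absolutely summable**. [cite: Balaban1983Higgs3, (3.16) p.437] -/
theorem summable_abs_smearG (hℓ : 1 ≤ ℓ) (hk : 1 ≤ k) (ha : 0 < a) (hm : 0 ≤ m2) (y : ZSite 3) :
    Summable fun z => |smearG ℓ k a m2 y z| := by
  obtain ⟨δ, C, hδ, hδh, hC, h⟩ := exists_smearG_profile hℓ a a m2 ha
  obtain ⟨hS, -⟩ := h k hk a m2 le_rfl le_rfl hm le_rfl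
  have hs := (summable_profile_row (xiOf_pos ℓ k) (xiOf_le_one ℓ k) hδ (hδh.trans (by norm_num)) (by norm_num : 1 ≤ 2)
    y).mul_left C
  exact Summable.of_nonneg_of_le (fun z => abs_nonneg _) (fun z => hS y z) hs

/-- **The translates of `C^ξ` are absolutely summable** (`C^ξ ≥ 0`, r15's `summable_Cxi`). [cite: Balaban1983Higgs3, (3.16) p.437] -/
theorem summable_abs_Cxi_translate {ξ : ℝ} (hξ : 0 < ξ) (y' : ZSite 3) :
    Summable fun z : ZSite 3 => |Cxi 3 ξ (z - y')| := by
  have h := (Equiv.subRight y').summable_iff.2 (summable_Cxi (d := 3) hξ)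
  refine h.congr fun z => ?_
  simp only [Function.comp_apply, Equiv.subRight_apply]
  rw [abs_of_nonneg (Cxi_nonneg hξ _)]

/-- **THE RESOLVENT IDENTITY ON THE PRINTED INFINITE LATTICE, PROVED** (p. 437, the unlabelled in-text display preceding (3.16):
*"Next we replace G^ξ_{j″}(0) by C^ξ = (−Δ^ξ + 1)^{−1}: G^ξ_{j″}(0) = C^ξ + G^ξ_{j″}(0)(1 − m²_{j″} − a_{j″}P_{j″})C^ξ."*): for every
`k ≥ 1`, `0 < a`, `0 ≤ m²` and all `y, y′ ∈ ℤ³`, `G^ξ_k(0;y,y′) − C^ξ(y−y′) = Σ'_z ξ³·[G^ξ_k(0)(1 − m² − a_kP_k)](y,z)·C^ξ(z − y′)`,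
the series converging absolutely — i.e. `G^ξ_{j″}(0) = C^ξ + G^ξ_{j″}(0)(1 − m²_{j″} − a_{j″}P_{j″})C^ξ` as kernels on ξℤ³, for the
infinite-lattice propagator `G_k(0)` of p. 433. [cite: Balaban1983Higgs3, (3.16) p.437] -/
theorem hasSum_resolvent316 (hℓ : 1 ≤ ℓ) (hk : 1 ≤ k) (ha : 0 < a) (hm : 0 ≤ m2) (y y' : ZSite 3) :
    HasSum (fun z => (xiOf ℓ k) ^ 3 * (smearG ℓ k a m2 y z * Cxi 3 (xiOf ℓ k) (z - y'))) (MxiL ℓ k a m2 y y') := by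
  have h := hasSum_resolvent_of_equations (xiOf_pos ℓ k).ne' (m2 := m2) (ak := B1.aSeq a ((ℓ : ℝ) + 1) k)
    (n := (ℓ + 1) ^ k) (g := GxiL ℓ k a m2 y) (c := fun z => Cxi 3 (xiOf ℓ k) (z - y')) (y := y) (y' := y')
    (fun x => by
      have hg := green_GxiL hℓ hk ha hm y x
      unfold blockAvg at hg
      rw [← Finset.mul_sum] at hg ⊢
      exact hg)
    (fun x => green_Cxi_translate (xiOf_pos ℓ k) y' x) (summable_abs_GxiL hℓ hk ha hm y)
    (summable_abs_Cxi_translate (xiOf_pos ℓ k) y')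
  have e : ∀ z, (xiOf ℓ k) ^ 3 * (smearG ℓ k a m2 y z * Cxi 3 (xiOf ℓ k) (z - y')) =
      (xiOf ℓ k) ^ 3 * (((1 - m2) * GxiL ℓ k a m2 y z - B1.aSeq a ((ℓ : ℝ) + 1) k *
        ∑ z' ∈ B4Reflection242.blockOf (d := 2) ((ℓ + 1) ^ k) z, xiOf ℓ k ^ 3 * GxiL ℓ k a m2 y z') *
          Cxi 3 (xiOf ℓ k) (z - y')) := fun z => rfl
  simp_rw [e]
  exact h

/-- **The resolvent identity (p. 437, display preceding (3.16)) as an equation of kernels**: `M(y,y′) = G^ξ − C^ξ =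
Σ'_z ξ³[G^ξ(1−m²−aP)](y,z)C^ξ(z−y′)`, and the summand is absolutely summable. [cite: Balaban1983Higgs3, (3.16) p.437] -/
theorem MxiL_eq_tsum (hℓ : 1 ≤ ℓ) (hk : 1 ≤ k) (ha : 0 < a) (hm : 0 ≤ m2) (y y' : ZSite 3) :
    MxiL ℓ k a m2 y y' = ∑' z, (xiOf ℓ k) ^ 3 * (smearG ℓ k a m2 y z * Cxi 3 (xiOf ℓ k) (z - y')) ∧
      Summable fun z => |(xiOf ℓ k) ^ 3 * (smearG ℓ k a m2 y z * Cxi 3 (xiOf ℓ k) (z - y'))| := by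
  refine ⟨(hasSum_resolvent316 hℓ hk ha hm y y').tsum_eq.symm, ?_⟩
  obtain ⟨B, hB⟩ : ∃ B, ∀ z : ZSite 3, |Cxi 3 (xiOf ℓ k) (z - y')| ≤ B :=
    ⟨_, abs_le_tsum_abs (summable_abs_Cxi_translate (xiOf_pos ℓ k) y')⟩
  have h := (summable_abs_mul_of_bdd (summable_abs_smearG hℓ hk ha hm y) hB).mul_left (|(xiOf ℓ k) ^ 3|)
  refine h.congr fun z => ?_
  exact (abs_mul _ _).symm

end Concrete

end

end Literature.MathematicalPhysics.QuantumFieldTheory.Balaban1983to89.B3Eq316ResolventZeroLattice
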